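import Mathlib
import Literature.Probability.LatticeModels.ProdBernoulliIndependence
import Literature.Probability.Percolation.KozmaNitzanPinning
import Literature.Probability.Percolation.ClusterBoundary
import HarnessLib

/-!
# Crux `PercNearOneGluing.NearOneGluing` (stmt-CriticalPhenomena-4574), line `bhk-dyadic-thinning` — sub-goal `pocketBound`, auxiliary file

Helper file for the crux (lead prover-line-stmt-CriticalPhenomena-4574-0, wave 2), serving the
registered sub-goal `pocketBound` (THE POCKET BOUND: decomposition of `{o ↔ A, o ↮ b}` by the
relay-free pocket `S = C_{V∖A}(o)` and contraction of the pocket to the single vertex `o`).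
Lands with `--supports stmt-CriticalPhenomena-4574`.

## Contents

* **Pushforward of a product Bernoulli measure under a block map.** If `Φ : Set ι → Set κ`
  (`ι`, `κ` finite) is such that the coordinate events `{ω | k ∈ Φ ω}` are determined by pairwise
  disjoint sets `G k` of coordinates, with marginals `P(k ∈ Φ ω) = q k`, then
  `P_p(Φ ⁻¹ Y) = P_q(Y)` for every event `Y` (`prodBernoulli_real_preimage_of_blocks`; proof by
  comparing atoms, `prodBernoulli_real_inter_biInter_of_determinedBy`). The special case of a
  *fiber map* `Φ ω = {k | ∃ e ∈ ω, π e = some k}` along `π : ι → Option κ` has product law with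
  `q k = 1 - ∏_{π e = k} (1 - p e)` (`prodBernoulli_real_preimage_fiberMap`, `exists_fiberWeights`).
* **The merge (contraction) map of a pocket.** For finite vertex sets `S₀ ∋ o` and `A` disjoint
  from `S₀`, the fiber map `π` keeping the pairs avoiding `S₀`, sending a pair `{x, a}` with
  `x ∈ S₀`, `a ∈ A` to `{o, a}`, and deleting all other pairs (`exists_mergeFiber`); membership in
  the merged configuration (`mk_mem_merge_iff`), isolation of `o` off `A` in the merged weights
  (`merge_ne_some`), locality (`determinedBy_preimage_merge`), and the first walk lemma: an open
  path `a → b` with the pocket boundary closed survives the contraction (`merge_mem_openConn`).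
  The pocket-specific walk lemma and the assembly are in the companion file
  `PercNearOneGluingNearOneGluingPocketBound.lean`.

All objects (`π`, `Φ`, the boundary pair set `F₀`) enter through characterising hypotheses and
existence lemmas, so that no new definitions are introduced. -/

namespace Summit.CriticalPhenomena.PercolationContinuityZ3.Theorems

open scoped BigOperators
open MeasureTheory Set
open Literature.Probability.LatticeModels
open Literature.Probability.Percolation

/-! ### Pushforward of `prodBernoulli` under a block map -/

section Blocks

variable {ι κ : Type*} [Fintype ι] [Fintype κ]

/-- **Atoms of the pushforward of a product measure under a block map.** If the coordinate events
`{ω | k ∈ Φ ω}` are determined by pairwise disjoint finite sets `G k` and have probabilities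
`q k`, then `P_p(Φ ω = η) = ∏_k (q k or 1 - q k)`. -/
theorem prodBernoulli_real_preimage_singleton_of_blocks (p : ι → unitInterval)
    (q : κ → unitInterval) (Φ : Set ι → Set κ) (G : κ → Finset ι)
    (hG : (Set.univ : Set κ).PairwiseDisjoint G)
    (hdet : ∀ k, DeterminedBy {ω | k ∈ Φ ω} (↑(G k) : Set ι))
    (hmarg : ∀ k, (prodBernoulli p).real {ω | k ∈ Φ ω} = q k) (η : Set κ)
    [DecidablePred (· ∈ η)] :
    (prodBernoulli p).real (Φ ⁻¹' {η}) = ∏ k, (if k ∈ η then (q k : ℝ) else 1 - q k) := by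
  have hpre : Φ ⁻¹' {η} =
      Set.univ ∩ ⋂ k ∈ (Finset.univ : Finset κ), {ω | k ∈ Φ ω ↔ k ∈ η} := by
    ext ω
    simp only [mem_preimage, mem_singleton_iff, univ_inter, mem_iInter, Finset.mem_univ,
      true_imp_iff, mem_setOf_eq, Set.ext_iff]
  have hC : ∀ k ∈ (Finset.univ : Finset κ),
      DeterminedBy {ω | k ∈ Φ ω ↔ k ∈ η} (↑(G k) : Set ι) := by
    intro k _
    rw [determinedBy_iff]
    intro ω ω' h
    have h1 := (determinedBy_iff _ _).1 (hdet k) ω ω' h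
    simp only [mem_setOf_eq] at h1 ⊢
    rw [h1]
  rw [hpre, prodBernoulli_real_inter_biInter_of_determinedBy p Finset.univ G (by simpa using hG)
    (C := fun k => {ω | k ∈ Φ ω ↔ k ∈ η}) hC (fun _ _ => MeasurableSet.of_discrete)
    (determinedBy_univ _) MeasurableSet.univ, probReal_univ, one_mul]
  refine Finset.prod_congr rfl fun k _ => ?_
  by_cases hk : k ∈ η
  · simp only [hk, iff_true]
    exact hmarg k
  · simp only [hk, iff_false, if_false]
    rw [show {ω | k ∉ Φ ω} = {ω | k ∈ Φ ω}ᶜ from rfl,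
      probReal_compl_eq_one_sub MeasurableSet.of_discrete, hmarg k]

/-- **Atoms of a product measure**: `P_q({η}) = ∏_k (q k or 1 - q k)`. -/
theorem prodBernoulli_real_singleton_eq_prod (q : κ → unitInterval) (η : Set κ)
    [DecidablePred (· ∈ η)] :
    (prodBernoulli q).real {η} = ∏ k, (if k ∈ η then (q k : ℝ) else 1 - q k) := by
  classical
  have h := prodBernoulli_real_preimage_singleton_of_blocks q q id (fun k => {k}) ?_ ?_ ?_ η
  · simpa using h
  · intro k _ k' _ hne
    change Disjoint ({k} : Finset κ) {k'}
    exact Finset.disjoint_singleton.2 hne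
  · intro k
    rw [determinedBy_iff]
    intro ω ω' h
    have h1 := Set.ext_iff.1 h k
    simp only [Finset.coe_singleton, mem_inter_iff, mem_singleton_iff, and_true] at h1
    simpa using h1
  · intro k
    simpa using prodBernoulli_real_setOf_mem q k

/-- **Pushforward of a product measure under a block map is a product measure**:
`P_p(Φ ⁻¹ Y) = P_q(Y)` for every event `Y`, under the hypotheses of
`prodBernoulli_real_preimage_singleton_of_blocks` (sum the atoms). -/
theorem prodBernoulli_real_preimage_of_blocks (p : ι → unitInterval) (q : κ → unitInterval)
    (Φ : Set ι → Set κ) (G : κ → Finset ι) (hG : (Set.univ : Set κ).PairwiseDisjoint G)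
    (hdet : ∀ k, DeterminedBy {ω | k ∈ Φ ω} (↑(G k) : Set ι))
    (hmarg : ∀ k, (prodBernoulli p).real {ω | k ∈ Φ ω} = q k) (Y : Set (Set κ)) :
    (prodBernoulli p).real (Φ ⁻¹' Y) = (prodBernoulli q).real Y := by
  classical
  have h1 : (prodBernoulli q).real Y = ∑ η ∈ Y.toFinset, (prodBernoulli q).real {η} := by
    rw [sum_measureReal_singleton, Set.coe_toFinset]
  have hU : Φ ⁻¹' Y = ⋃ η ∈ Y.toFinset, Φ ⁻¹' {η} := by ext ω; simp
  have h2 : (prodBernoulli p).real (Φ ⁻¹' Y) =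
      ∑ η ∈ Y.toFinset, (prodBernoulli p).real (Φ ⁻¹' {η}) := by
    rw [hU]
    refine measureReal_biUnion_finset (fun η _ η' _ hne => ?_) (fun _ _ => MeasurableSet.of_discrete)
    refine Set.disjoint_left.2 fun ω h h' => hne ?_
    rw [mem_preimage, mem_singleton_iff] at h h'
    rw [← h, ← h']
  rw [h1, h2]
  refine Finset.sum_congr rfl fun η _ => ?_
  rw [prodBernoulli_real_preimage_singleton_of_blocks p q Φ G hG hdet hmarg,
    prodBernoulli_real_singleton_eq_prod]

/-- **Fiber maps.** Along `π : ι → Option κ`, the map `Φ ω = {k | ∃ e ∈ ω, π e = some k}`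
("coordinate `k` is present iff some coordinate of its fiber is present") pushes `prodBernoulli p`
to `prodBernoulli q` with `q k = 1 - ∏_{π e = some k} (1 - p e)`. -/
theorem prodBernoulli_real_preimage_fiberMap [DecidableEq κ] (p : ι → unitInterval)
    (q : κ → unitInterval) (π : ι → Option κ) (Φ : Set ι → Set κ)
    (hΦ : ∀ ω k, k ∈ Φ ω ↔ ∃ e ∈ ω, π e = some k)
    (hq : ∀ k, (q k : ℝ) = 1 - ∏ e ∈ Finset.univ.filter (fun e => π e = some k), (1 - (p e : ℝ)))
    (Y : Set (Set κ)) :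
    (prodBernoulli p).real (Φ ⁻¹' Y) = (prodBernoulli q).real Y := by
  refine prodBernoulli_real_preimage_of_blocks p q Φ
    (fun k => Finset.univ.filter fun e => π e = some k) ?_ ?_ ?_ Y
  · intro k _ k' _ hne
    change Disjoint (Finset.univ.filter fun e => π e = some k)
      (Finset.univ.filter fun e => π e = some k')
    rw [Finset.disjoint_left]
    intro e he he'
    simp only [Finset.mem_filter, Finset.mem_univ, true_and] at he he'
    exact hne (Option.some_injective _ (he.symm.trans he'))
  · intro k
    rw [determinedBy_iff]
    intro ω ω' h
    have key : ∀ e, π e = some k → (e ∈ ω ↔ e ∈ ω') := fun e he => by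
      have h1 := Set.ext_iff.1 h e
      simp only [mem_inter_iff, Finset.coe_filter, Finset.mem_univ, true_and, mem_setOf_eq, he,
        and_true] at h1
      exact h1
    simp only [mem_setOf_eq, hΦ]
    exact ⟨fun ⟨e, heω, he⟩ => ⟨e, (key e he).1 heω, he⟩,
      fun ⟨e, heω, he⟩ => ⟨e, (key e he).2 heω, he⟩⟩
  · intro k
    have hset : {ω : Set ι | k ∈ Φ ω} =
        {ω | ∀ e ∈ Finset.univ.filter (fun e => π e = some k), e ∉ ω}ᶜ := by
      ext ω
      simp only [mem_setOf_eq, hΦ, mem_compl_iff, not_forall, Finset.mem_filter, Finset.mem_univ,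
        true_and, not_not, exists_prop]
      exact ⟨fun ⟨e, heω, he⟩ => ⟨e, he, heω⟩, fun ⟨e, he, heω⟩ => ⟨e, heω, he⟩⟩
    rw [hset, probReal_compl_eq_one_sub MeasurableSet.of_discrete, prodBernoulli_real_forall_notMem,
      hq]

omit [Fintype κ] in
/-- The fiber weights `q k = 1 - ∏_{π e = some k} (1 - p e)` exist as elements of `[0, 1]`. -/
theorem exists_fiberWeights [DecidableEq κ] (p : ι → unitInterval) (π : ι → Option κ) :
    ∃ q : κ → unitInterval, ∀ k, (q k : ℝ) =
      1 - ∏ e ∈ Finset.univ.filter (fun e => π e = some k), (1 - (p e : ℝ)) := by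
  refine ⟨fun k => unitInterval.symm ⟨∏ e ∈ Finset.univ.filter (fun e => π e = some k),
    (1 - (p e : ℝ)), unitInterval.prod_mem fun e _ => ⟨sub_nonneg.2 (p e).2.2,
      sub_le_self _ (p e).2.1⟩⟩, fun k => ?_⟩
  rw [unitInterval.coe_symm_eq]

end Blocks

/-! ### The merge map of a pocket -/

section Merge

variable {n : ℕ} {S₀ A : Finset (Fin n)} {o : Fin n}
  {π : Sym2 (Fin n) → Option (Sym2 (Fin n))} {Φ : Set (Sym2 (Fin n)) → Set (Sym2 (Fin n))}
  {F₀ : Finset (Sym2 (Fin n))}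

/-- **The merge fiber of a pocket exists**: pairs avoiding `S₀` are kept, a pair `{x, a}` with
`x ∈ S₀`, `a ∈ A` becomes `{o, a}`, every other pair is deleted. -/
theorem exists_mergeFiber (S₀ A : Finset (Fin n)) (o : Fin n) (hSA : Disjoint S₀ A) :
    ∃ π : Sym2 (Fin n) → Option (Sym2 (Fin n)),
      (∀ x y, x ∉ S₀ → y ∉ S₀ → π s(x, y) = some s(x, y)) ∧
      (∀ x y, x ∈ S₀ → y ∈ A → π s(x, y) = some s(o, y)) ∧
      (∀ x y k, π s(x, y) = some k → (x ∉ S₀ ∧ y ∉ S₀ ∧ k = s(x, y)) ∨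
        (x ∈ S₀ ∧ y ∈ A ∧ k = s(o, y)) ∨ (y ∈ S₀ ∧ x ∈ A ∧ k = s(o, x))) := by
  refine ⟨Sym2.lift ⟨fun x y => if x ∉ S₀ ∧ y ∉ S₀ then some s(x, y)
      else if x ∈ S₀ ∧ y ∈ A then some s(o, y) else if y ∈ S₀ ∧ x ∈ A then some s(o, x) else none,
      fun x y => ?_⟩, fun x y hx hy => ?_, fun x y hx hy => ?_, fun x y k hk => ?_⟩
  · show (if x ∉ S₀ ∧ y ∉ S₀ then some s(x, y) else if x ∈ S₀ ∧ y ∈ A then some s(o, y)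
        else if y ∈ S₀ ∧ x ∈ A then some s(o, x) else none) =
      (if y ∉ S₀ ∧ x ∉ S₀ then some s(y, x) else if y ∈ S₀ ∧ x ∈ A then some s(o, x)
        else if x ∈ S₀ ∧ y ∈ A then some s(o, y) else none)
    by_cases hx : x ∈ S₀ <;> by_cases hy : y ∈ S₀
    · have hxA : x ∉ A := Finset.disjoint_left.1 hSA hx
      have hyA : y ∉ A := Finset.disjoint_left.1 hSA hy
      simp [hx, hy, hxA, hyA]
    · simp [hx, hy]
    · simp [hx, hy]
    · simp [hx, hy, Sym2.eq_swap]
  · rw [Sym2.lift_mk]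
    show (if x ∉ S₀ ∧ y ∉ S₀ then some s(x, y) else _) = _
    rw [if_pos ⟨hx, hy⟩]
  · rw [Sym2.lift_mk]
    show (if x ∉ S₀ ∧ y ∉ S₀ then some s(x, y) else if x ∈ S₀ ∧ y ∈ A then some s(o, y) else _) = _
    rw [if_neg fun h => h.1 hx, if_pos ⟨hx, hy⟩]
  · rw [Sym2.lift_mk] at hk
    change (if x ∉ S₀ ∧ y ∉ S₀ then some s(x, y) else if x ∈ S₀ ∧ y ∈ A then some s(o, y)
        else if y ∈ S₀ ∧ x ∈ A then some s(o, x) else none) = some k at hk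
    split_ifs at hk with h1 h2 h3
    · exact Or.inl ⟨h1.1, h1.2, (Option.some_injective _ hk).symm⟩
    · exact Or.inr (Or.inl ⟨h2.1, h2.2, (Option.some_injective _ hk).symm⟩)
    · exact Or.inr (Or.inr ⟨h3.1, h3.2, (Option.some_injective _ hk).symm⟩)

/-- **The boundary pair set of a pocket exists**: the pairs joining `S₀` to a vertex outside
`S₀ ∪ A`. -/
theorem exists_boundaryPairs (S₀ A : Finset (Fin n)) :
    ∃ F₀ : Finset (Sym2 (Fin n)), ∀ x y, s(x, y) ∈ F₀ ↔
      (x ∈ S₀ ∧ y ∉ S₀ ∧ y ∉ A) ∨ (y ∈ S₀ ∧ x ∉ S₀ ∧ x ∉ A) := by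
  classical
  refine ⟨Finset.univ.filter fun e => ∃ x ∈ e, ∃ y ∈ e, x ∈ S₀ ∧ y ∉ S₀ ∧ y ∉ A, fun x y => ?_⟩
  simp only [Finset.mem_filter, Finset.mem_univ, true_and, Sym2.mem_iff]
  constructor
  · rintro ⟨a, ha, b, hb, haS, hbS, hbA⟩
    rcases ha with rfl | rfl <;> rcases hb with rfl | rfl
    · exact absurd haS hbS
    · exact Or.inl ⟨haS, hbS, hbA⟩
    · exact Or.inr ⟨haS, hbS, hbA⟩
    · exact absurd haS hbS
  · rintro (⟨hx, hy, hyA⟩ | ⟨hy, hx, hxA⟩)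
    · exact ⟨x, Or.inl rfl, y, Or.inr rfl, hx, hy, hyA⟩
    · exact ⟨y, Or.inr rfl, x, Or.inl rfl, hy, hx, hxA⟩

/-- **Membership in the merged configuration.** A pair `{u, v}` is open in `Φ ω` iff it avoids
`S₀` and is open in `ω`, or it is `{o, a}` with `a ∈ A` and some pair `{x, a}`, `x ∈ S₀`, is open
in `ω`. -/
theorem mk_mem_merge_iff
    (hπ1 : ∀ x y, x ∉ S₀ → y ∉ S₀ → π s(x, y) = some s(x, y))
    (hπ2 : ∀ x y, x ∈ S₀ → y ∈ A → π s(x, y) = some s(o, y))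
    (hπ3 : ∀ x y k, π s(x, y) = some k → (x ∉ S₀ ∧ y ∉ S₀ ∧ k = s(x, y)) ∨
      (x ∈ S₀ ∧ y ∈ A ∧ k = s(o, y)) ∨ (y ∈ S₀ ∧ x ∈ A ∧ k = s(o, x)))
    (hΦ : ∀ ω k, k ∈ Φ ω ↔ ∃ e ∈ ω, π e = some k) (ω : Set (Sym2 (Fin n))) (u v : Fin n) :
    s(u, v) ∈ Φ ω ↔ (u ∉ S₀ ∧ v ∉ S₀ ∧ s(u, v) ∈ ω) ∨ (u = o ∧ v ∈ A ∧ ∃ x ∈ S₀, s(x, v) ∈ ω) ∨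
      (v = o ∧ u ∈ A ∧ ∃ x ∈ S₀, s(x, u) ∈ ω) := by
  rw [hΦ]
  constructor
  · rintro ⟨e, heω, he⟩
    revert heω he
    refine Sym2.inductionOn e fun x y => ?_
    intro hxy h
    rcases hπ3 x y _ h with ⟨hx, hy, hk⟩ | ⟨hx, hy, hk⟩ | ⟨hy, hx, hk⟩
    · rcases Sym2.eq_iff.1 hk with ⟨rfl, rfl⟩ | ⟨rfl, rfl⟩
      · exact Or.inl ⟨hx, hy, hxy⟩
      · exact Or.inl ⟨hy, hx, by rw [Sym2.eq_swap]; exact hxy⟩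
    · rcases Sym2.eq_iff.1 hk with ⟨rfl, rfl⟩ | ⟨rfl, rfl⟩
      · exact Or.inr (Or.inl ⟨rfl, hy, x, hx, hxy⟩)
      · exact Or.inr (Or.inr ⟨rfl, hy, x, hx, hxy⟩)
    · rcases Sym2.eq_iff.1 hk with ⟨rfl, rfl⟩ | ⟨rfl, rfl⟩
      · exact Or.inr (Or.inl ⟨rfl, hx, y, hy, by rw [Sym2.eq_swap]; exact hxy⟩)
      · exact Or.inr (Or.inr ⟨rfl, hx, y, hy, by rw [Sym2.eq_swap]; exact hxy⟩)
  · rintro (⟨hu, hv, h⟩ | ⟨rfl, hv, x, hx, h⟩ | ⟨rfl, hu, x, hx, h⟩)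
    · exact ⟨s(u, v), h, hπ1 u v hu hv⟩
    · exact ⟨s(x, v), h, hπ2 x v hx hv⟩
    · exact ⟨s(x, u), h, by rw [hπ2 x u hx hu, Sym2.eq_swap]⟩

/-- **Isolation of `o` off `A` in the merged world**: no pair is merged onto `{o, z}` when
`z ∉ A`, `z ≠ o` (so the merged weight of `{o, z}` vanishes). -/
theorem merge_ne_some
    (hπ3 : ∀ x y k, π s(x, y) = some k → (x ∉ S₀ ∧ y ∉ S₀ ∧ k = s(x, y)) ∨
      (x ∈ S₀ ∧ y ∈ A ∧ k = s(o, y)) ∨ (y ∈ S₀ ∧ x ∈ A ∧ k = s(o, x)))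
    (ho : o ∈ S₀) {z : Fin n} (hzA : z ∉ A) (hzo : z ≠ o) (e : Sym2 (Fin n)) :
    π e ≠ some s(o, z) := by
  induction e using Sym2.ind with
  | _ x y =>
  intro h
  rcases hπ3 x y _ h with ⟨hx, hy, hk⟩ | ⟨-, hy, hk⟩ | ⟨-, hx, hk⟩
  · have : o ∈ s(x, y) := by rw [← hk]; exact Sym2.mem_mk_left o z
    rcases Sym2.mem_iff.1 this with rfl | rfl
    exacts [hx ho, hy ho]
  · rcases Sym2.eq_iff.1 hk with ⟨-, rfl⟩ | ⟨rfl, rfl⟩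
    · exact hzA hy
    · exact hzo rfl
  · rcases Sym2.eq_iff.1 hk with ⟨-, rfl⟩ | ⟨rfl, rfl⟩
    · exact hzA hx
    · exact hzo rfl

/-- A merged pair comes from a pair that is neither inside `S₀` nor a boundary pair of the
pocket. -/
theorem notMem_of_merge_eq_some
    (hπ3 : ∀ x y k, π s(x, y) = some k → (x ∉ S₀ ∧ y ∉ S₀ ∧ k = s(x, y)) ∨
      (x ∈ S₀ ∧ y ∈ A ∧ k = s(o, y)) ∨ (y ∈ S₀ ∧ x ∈ A ∧ k = s(o, x)))
    (hF₀ : ∀ x y, s(x, y) ∈ F₀ ↔ (x ∈ S₀ ∧ y ∉ S₀ ∧ y ∉ A) ∨ (y ∈ S₀ ∧ x ∉ S₀ ∧ x ∉ A))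
    (hSA : Disjoint S₀ A) {e k : Sym2 (Fin n)} (he : π e = some k) :
    e ∉ S₀.sym2 ∧ e ∉ F₀ := by
  revert he
  induction e using Sym2.ind with
  | _ x y =>
  intro he
  rw [Finset.mk_mem_sym2_iff, hF₀]
  rcases hπ3 x y k he with ⟨hx, hy, -⟩ | ⟨hx, hy, -⟩ | ⟨hy, hx, -⟩
  · exact ⟨fun h => hx h.1, fun h => h.elim (fun h' => hx h'.1) (fun h' => hy h'.1)⟩
  · have hyS : y ∉ S₀ := fun h => Finset.disjoint_left.1 hSA h hy
    exact ⟨fun h => hyS h.2, fun h => h.elim (fun h' => h'.2.2 hy) (fun h' => hyS h'.1)⟩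
  · have hxS : x ∉ S₀ := fun h => Finset.disjoint_left.1 hSA h hx
    exact ⟨fun h => hxS h.1, fun h => h.elim (fun h' => hxS h'.1) (fun h' => h'.2.2 hx)⟩

/-- **Locality of the merge map**: the pull-back of every event along `Φ` is determined by the
pairs that are neither inside `S₀` nor boundary pairs of the pocket. -/
theorem determinedBy_preimage_merge
    (hπ3 : ∀ x y k, π s(x, y) = some k → (x ∉ S₀ ∧ y ∉ S₀ ∧ k = s(x, y)) ∨
      (x ∈ S₀ ∧ y ∈ A ∧ k = s(o, y)) ∨ (y ∈ S₀ ∧ x ∈ A ∧ k = s(o, x)))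
    (hΦ : ∀ ω k, k ∈ Φ ω ↔ ∃ e ∈ ω, π e = some k)
    (hF₀ : ∀ x y, s(x, y) ∈ F₀ ↔ (x ∈ S₀ ∧ y ∉ S₀ ∧ y ∉ A) ∨ (y ∈ S₀ ∧ x ∉ S₀ ∧ x ∉ A))
    (hSA : Disjoint S₀ A) (Y : Set (Set (Sym2 (Fin n)))) :
    DeterminedBy (Φ ⁻¹' Y) (↑(S₀.sym2 ∪ F₀)ᶜ : Set (Sym2 (Fin n))) := by
  rw [determinedBy_iff]
  intro ω ω' h
  have key : ∀ e k, π e = some k → (e ∈ ω ↔ e ∈ ω') := by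
    intro e k he
    have hmem : e ∈ (↑(S₀.sym2 ∪ F₀)ᶜ : Set (Sym2 (Fin n))) := by
      have h' := notMem_of_merge_eq_some hπ3 hF₀ hSA he
      rw [Finset.coe_compl, mem_compl_iff, Finset.coe_union, mem_union, Finset.mem_coe,
        Finset.mem_coe, not_or]
      exact h'
    have h1 := Set.ext_iff.1 h e
    simp only [mem_inter_iff, hmem, and_true] at h1
    exact h1
  have hΦeq : Φ ω = Φ ω' := by
    ext k
    simp only [hΦ]
    exact ⟨fun ⟨e, heω, he⟩ => ⟨e, (key e k he).1 heω, he⟩,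
      fun ⟨e, heω, he⟩ => ⟨e, (key e k he).2 heω, he⟩⟩
  simp only [mem_preimage, hΦeq]

/-- **Walk lemma (reliability transfer).** If `a, b ∉ S₀`, `a ↔ b` in `ω`, and every boundary
pair of the pocket is closed in `ω`, then `a ↔ b` in the merged configuration: an open path can
only enter and leave `S₀` through vertices of `A`, and each such excursion becomes `a₁ – o – a₂`. -/
theorem merge_mem_openConn
    (hΦ' : ∀ ω u v, s(u, v) ∈ Φ ω ↔ (u ∉ S₀ ∧ v ∉ S₀ ∧ s(u, v) ∈ ω) ∨
      (u = o ∧ v ∈ A ∧ ∃ x ∈ S₀, s(x, v) ∈ ω) ∨ (v = o ∧ u ∈ A ∧ ∃ x ∈ S₀, s(x, u) ∈ ω))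
    (hF₀ : ∀ x y, s(x, y) ∈ F₀ ↔ (x ∈ S₀ ∧ y ∉ S₀ ∧ y ∉ A) ∨ (y ∈ S₀ ∧ x ∉ S₀ ∧ x ∉ A))
    (ho : o ∈ S₀) {a b : Fin n} (ha : a ∉ S₀) (hb : b ∉ S₀) {ω : Set (Sym2 (Fin n))}
    (hab : ω ∈ openConn a b) (hcl : ∀ e ∈ F₀, e ∉ ω) : Φ ω ∈ openConn a b := by
  have hp : PathIn (openGraph ω) Set.univ a b := DCT16.pathIn_univ_of_reachable hab
  have exitA : ∀ x y, x ∈ S₀ → y ∉ S₀ → s(x, y) ∈ ω → y ∈ A := fun x y hx hy hxy => by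
    by_contra hyA
    exact hcl _ ((hF₀ x y).2 (Or.inl ⟨hx, hy, hyA⟩)) hxy
  have adjO : ∀ x y, x ∈ S₀ → y ∈ A → y ∉ S₀ → s(x, y) ∈ ω → (openGraph (Φ ω)).Adj o y :=
    fun x y hx hy hyS hxy => by
      rw [openGraph_adj]
      exact ⟨(hΦ' ω o y).2 (Or.inr (Or.inl ⟨rfl, hy, x, hx, hxy⟩)), fun h => hyS (h ▸ ho)⟩
  have key := DCT16.pathIn_induction
    (fun z => (z ∉ S₀ → (openGraph (Φ ω)).Reachable a z) ∧
      (z ∈ S₀ → (openGraph (Φ ω)).Reachable a o))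
    hp ⟨fun _ => SimpleGraph.Reachable.refl _, fun h => absurd h ha⟩ ?_
  · exact key.1 hb
  intro u v _ _ hPu huv
  rw [openGraph_adj] at huv
  obtain ⟨huv, hne⟩ := huv
  by_cases hu : u ∈ S₀ <;> by_cases hv : v ∈ S₀
  · exact ⟨fun h => absurd hv h, fun _ => hPu.2 hu⟩
  · refine ⟨fun _ => ?_, fun h => absurd h hv⟩
    exact (hPu.2 hu).trans (adjO u v hu (exitA u v hu hv huv) hv huv).reachable
  · refine ⟨fun h => absurd hv h, fun _ => ?_⟩
    have hvu : s(v, u) ∈ ω := by rw [Sym2.eq_swap]; exact huv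
    exact (hPu.1 hu).trans (adjO v u hv (exitA v u hv hu hvu) hu hvu).symm.reachable
  · refine ⟨fun _ => (hPu.1 hu).trans (SimpleGraph.Adj.reachable ?_), fun h => absurd h hv⟩
    rw [openGraph_adj]
    exact ⟨(hΦ' ω u v).2 (Or.inl ⟨hu, hv, huv⟩), hne⟩

end Merge

/-- **Pushforward of `prodBernoulli` under a fiber map, on pair configurations of `Fin n`**
(registered auxiliary sub-goal `pocketBoundAux` of `pocketBound`): if
`Φ ω = {k | ∃ e ∈ ω, π e = some k}` and `w' k = 1 - ∏_{π e = some k} (1 - w e)`, then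
`P_w(Φ ⁻¹ Y) = P_{w'}(Y)` for every event `Y` (the law of the contracted configuration is again a
product Bernoulli measure). -/
theorem pocketBoundAux :
    ∀ (n : ℕ) (w w' : Sym2 (Fin n) → unitInterval) (π : Sym2 (Fin n) → Option (Sym2 (Fin n)))
      (Φ : Set (Sym2 (Fin n)) → Set (Sym2 (Fin n))),
      (∀ (ω : Set (Sym2 (Fin n))) (k : Sym2 (Fin n)), k ∈ Φ ω ↔ ∃ e ∈ ω, π e = some k) →
      (∀ k : Sym2 (Fin n), (w' k : ℝ) =
          1 - ∏ e ∈ (Finset.univ : Finset (Sym2 (Fin n))).filter (fun e => π e = some k),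
            (1 - (w e : ℝ))) →
      ∀ Y : Set (Set (Sym2 (Fin n))),
        (Literature.Probability.LatticeModels.prodBernoulli w).real (Φ ⁻¹' Y) =
          (Literature.Probability.LatticeModels.prodBernoulli w').real Y :=
  fun _ w w' π Φ hΦ hw' Y => prodBernoulli_real_preimage_fiberMap w w' π Φ hΦ hw' Y

end Summit.CriticalPhenomena.PercolationContinuityZ3.Theorems
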